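import Literature.Claims.NS.Iotti2025
import Literature.Analysis.FluidPDE.ClassicalNSBlowupAlternative
import HarnessLib

/-!
# Solo salvage for claim C28b `Iotti2025` (cell `ns-claims`, D-0090): Step 2 — the `L^∞` continuation
# criterion (Thm 3.1 (ii) p.4), kernel-discharged from the tree's theorems

Claim skeleton: `Literature/Claims/NS/Iotti2025.lean` (M. Iotti, «A uniform bound for solutions to the
Navier–Stokes and Euler equations», 2025; adjudicated row C28b: first failing step `Step_3b` = the
inference (4.7) ⇒ (4.8) in the proof of Lemma 4.1 p.7–8, class false lemma, kernel
`Summit.NavierStokesRegularity.NavierStokesRegularity.Theorems.Iotti2025.not_Step_3b`).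

This file (seat `ns-claims-salvage-p2`) discharges the on-path binder `h2` of `claim_of_steps`, which sits
BEFORE the locator:

* `step2_holds : Step_2` — Thm 3.1 (ii) p.4 as used on p.10 («Since `lim_{t→T*} ‖u(t)‖_∞ < ∞`, by
  Theorem 3.1 (ii), the solution `u` can be extended for all `t ≥ 0`»): for `ν > 0`, a solution of the
  class on `[0,T)` (classical, all `L²` Sobolev norms bounded on every `[0,T'']`, `T'' < T` — the tree's
  Beale–Kato–Majda class, `Literature.Claims.NS.Chae2007.IsLocalSolution`) whose velocity is bounded on
  some `[ε,T) × ℝ³` does NOT blow up at `T` (`¬ Chae2007.BlowsUpAt T u`: the squared `H³` size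
  `Σ_{n≤3} ∫‖Dⁿu(t)‖²` stays bounded on `[0,T)`).

ORIGINAL SOURCE of the step: J. Leray, Acta Math. 63 (1934) §33 (the regular solution ends only where
`max |u|` becomes infinite); J. Serrin 1962 / the `L^∞_tL^∞_x` Prodi–Serrin class; for the `H^m` class
T. Kato 1972 and Majda–Bertozzi 2002 §3.3 — not the claim. In the tree the ingredients are THEOREMS:

* `Literature.Analysis.FluidPDE.finiteEnergy_classical_dichotomy` (`ClassicalNSBlowupAlternative`): for
  `ν > 0` and an `H^∞` divergence-free datum, either every closed slab `[0,T']` carries a finite-energy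
  classical solution, or there is a maximal finite-energy classical solution on some `[0,T*)` whose
  velocity is UNBOUNDED on `[0,T*) × ℝ³` and past which no finite-energy classical solution exists;
* `IsClassicalNSSolutionOn.hasBoundedSobolevNormsOn_of_sobolevDatum_unforced` (`NSTaoClassOfSobolevDatum`,
  Tao 2013 Cor. 11.1): a finite-energy classical solution on a CLOSED slab from an `H^∞` datum has all
  Sobolev norms bounded there;
* `MajdaBertozzi2002_uniquenessSobolev_holds` (Majda–Bertozzi Cor. 3.1): uniqueness in the BKM class on
  closed slabs;
* `HasBoundedSobolevNormsOn.exists_forall_norm_iteratedFDeriv_le` (Sobolev embedding): the BKM class is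
  pointwise bounded on closed slabs.

Assembly: run the dichotomy from the datum `u 0`. A finite-energy classical solution on a closed slab
`[0,S]`, `S ≥ T`, is in the BKM class on `[0,S]` (Tao) and agrees with `u` on every `[0,t]`, `t < T`
(uniqueness), so `u`'s `H³` size on `[0,T)` is bounded by the sum of four of its constants
(`not_blowsUpAt_of_finiteEnergy_slab`); this settles the global branch and the case `T* > T`. If
`T* < T`, `u` itself restricted to `[0,T*]` is a finite-energy classical continuation — excluded by
maximality. If `T* = T`, the maximal solution equals `u` on `[0,T)` (uniqueness on each `[0,t]`), but
`u` is bounded on `[0,T) × ℝ³` (by `M` on `[ε,T)`, by the Sobolev bound on `[0,ε]`), contradicting the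
sup blow-up. The hypothesis is used only in the last case — exactly Leray's §33.

Nothing in the verdict / locator / class / statements of C28b changes; D-0026 discharge of a TRUE step
(DEBT-LEDGER / DEBT-TRIAGE 2026-08-27: `Iotti2025.Step_2` OPEN, «L»). Solo lane
(`Theorems/SoloSalvage<Slug>.lean`, no item).

WHAT THIS IS NOT: not a claim about NS regularity or blow-up; not a claim about any author beyond the
typed locator.
-/

noncomputable section

open Set MeasureTheory
open scoped ENNReal NNReal ContDiff

-- The mandated landing namespace repeats the summit name by design (D-0017).
set_option linter.dupNamespace false

namespace Summit.NavierStokesRegularity.NavierStokesRegularity.Theorems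

namespace Iotti2025

open Literature.Claims.NS.Iotti2025 Literature.Claims.NS.Chae2007 Literature.Analysis.FluidPDE

variable {ν T : ℝ} {v₀ : EuclideanSpace ℝ (Fin 3) → EuclideanSpace ℝ (Fin 3)}
  {u w : ℝ → EuclideanSpace ℝ (Fin 3) → EuclideanSpace ℝ (Fin 3)} {p q : ℝ → EuclideanSpace ℝ (Fin 3) → ℝ}

/-- **The datum of a solution of the class is an `H^∞` datum**: `u 0` is `C^∞`, divergence free and has
every derivative in `L²` (slice regularity at `t = 0 ∈ [0,T)` and the Sobolev bounds on `[0,0]`).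
[cite: Iotti2025UniformBound, Thm 3.1 (i) p.3–4] -/
theorem datum_of_isLocalSolution (hT : 0 < T) (hloc : IsLocalSolution ν T v₀ u p) :
    ContDiff ℝ ∞ (u 0) ∧ VectorCalculus.IsDivFree (u 0) ∧
      ∀ n : ℕ, ∫⁻ x, ‖iteratedFDeriv ℝ n (u 0) x‖ₑ ^ 2 < ⊤ := by
  have h0 : (0 : ℝ) ∈ Ico 0 T := ⟨le_rfl, hT⟩
  refine ⟨hloc.isClassical.contDiff_velocity h0, hloc.isClassical.divFree 0 h0, fun n => ?_⟩
  obtain ⟨C, hC⟩ := hloc.sobolev 0 hT n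
  exact (hC 0 ⟨le_rfl, le_rfl⟩).trans_lt ENNReal.coe_lt_top

/-- **Uniqueness against a finite-energy classical solution on a closed sub-slab** (Tao 2013 Cor. 11.1 +
Majda–Bertozzi Cor. 3.1, tree theorems): if `(w, q)` is a classical solution on `[0,t] × ℝ³`,
`0 < t < T`, from the same datum with finite energy, then `w(t) = u(t)` for the solution `u` of the class
on `[0,T)`. [cite: Iotti2025UniformBound, Thm 3.1 (i)-(ii) p.3–4] -/
theorem eq_of_finiteEnergy_slab (hν : 0 < ν) (hloc : IsLocalSolution ν T v₀ u p) {t : ℝ}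
    (ht0 : 0 < t) (htT : t < T) (hw : IsClassicalNSSolutionOn (Icc 0 t) ν 0 w q) (hw0 : w 0 = u 0)
    (hE : ∃ A : ℝ≥0∞, A < ⊤ ∧ ∀ s ∈ Icc 0 t, ∫⁻ x, ‖w s x‖ₑ ^ 2 ≤ A) :
    w t = u t := by
  have hT : 0 < T := ht0.trans htT
  obtain ⟨-, -, hH⟩ := datum_of_isLocalSolution hT hloc
  -- finite energy as an `ℝ≥0` constant
  have hE' : ∃ C : ℝ≥0, ∀ s ∈ Icc 0 t, ∫⁻ x, ‖w s x‖ₑ ^ 2 ≤ C := by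
    obtain ⟨A, hA, hAw⟩ := hE
    exact ⟨A.toNNReal, fun s hs => by rw [ENNReal.coe_toNNReal hA.ne]; exact hAw s hs⟩
  have h₀ : ∀ m : ℕ, ∫⁻ x, ‖iteratedFDeriv ℝ m (w 0) x‖ₑ ^ 2 < ⊤ := fun m => by rw [hw0]; exact hH m
  -- Tao's class: all Sobolev norms of `w` bounded on `[0, t]`
  have hBw : HasBoundedSobolevNormsOn (Icc 0 t) w :=
    hw.hasBoundedSobolevNormsOn_of_sobolevDatum_unforced hν ht0 hE' h₀
  -- `u` on the closed sub-slab `[0, t]`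
  have hu : IsClassicalNSSolutionOn (Icc 0 t) ν 0 u p :=
    hloc.isClassical.mono (Icc_subset_Ico_right htT) (uniqueDiffOn_Icc ht0)
  have hBu : HasBoundedSobolevNormsOn (Icc 0 t) u := hloc.sobolev t htT
  exact MajdaBertozzi2002_uniquenessSobolev_holds hν.le ht0 hw hu hBw hBu hw0 t ⟨ht0.le, le_rfl⟩

/-- **No blow-up at `T` if some closed slab `[0,S]`, `S ≥ T`, carries a finite-energy classical solution
from the same datum**: that solution is in the BKM class on `[0,S]` (Tao 2013 Cor. 11.1) and agrees with
`u` on `[0,T)` (uniqueness), so `Σ_{n≤3} ∫‖Dⁿu(t)‖²` is bounded on `[0,T)` by the sum of four of its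
constants. [cite: Iotti2025UniformBound, Thm 3.1 (ii) p.4] -/
theorem not_blowsUpAt_of_finiteEnergy_slab (hν : 0 < ν) (hT : 0 < T)
    (hloc : IsLocalSolution ν T v₀ u p) {S : ℝ} (hTS : T ≤ S)
    (hw : IsClassicalNSSolutionOn (Icc 0 S) ν 0 w q) (hw0 : w 0 = u 0)
    (hE : ∃ A : ℝ≥0∞, A < ⊤ ∧ ∀ s ∈ Icc 0 S, ∫⁻ x, ‖w s x‖ₑ ^ 2 ≤ A) :
    ¬ BlowsUpAt T u := by
  have hS : 0 < S := hT.trans_le hTS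
  obtain ⟨-, -, hH⟩ := datum_of_isLocalSolution hT hloc
  have hE' : ∃ C : ℝ≥0, ∀ s ∈ Icc 0 S, ∫⁻ x, ‖w s x‖ₑ ^ 2 ≤ C := by
    obtain ⟨A, hA, hAw⟩ := hE
    exact ⟨A.toNNReal, fun s hs => by rw [ENNReal.coe_toNNReal hA.ne]; exact hAw s hs⟩
  have h₀ : ∀ m : ℕ, ∫⁻ x, ‖iteratedFDeriv ℝ m (w 0) x‖ₑ ^ 2 < ⊤ := fun m => by rw [hw0]; exact hH m
  have hBw : HasBoundedSobolevNormsOn (Icc 0 S) w :=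
    hw.hasBoundedSobolevNormsOn_of_sobolevDatum_unforced hν hS hE' h₀
  choose C hC using hBw
  -- `u = w` on `[0, T)`
  have heq : ∀ t ∈ Ico 0 T, u t = w t := by
    intro t ht
    rcases ht.1.eq_or_lt with h0 | ht0
    · rw [← h0, hw0]
    · have hwt : IsClassicalNSSolutionOn (Icc 0 t) ν 0 w q :=
        hw.mono (Icc_subset_Icc_right (ht.2.le.trans hTS)) (uniqueDiffOn_Icc ht0)
      obtain ⟨A, hA, hAw⟩ := hE
      exact (eq_of_finiteEnergy_slab hν hloc ht0 ht.2 hwt hw0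
        ⟨A, hA, fun s hs => hAw s ⟨hs.1, hs.2.trans (ht.2.le.trans hTS)⟩⟩).symm
  -- the bound
  intro hblow
  refine hblow ⟨∑ n ∈ Finset.range 4, C n, fun t ht => ?_⟩
  rw [heq t ht]
  push_cast
  exact Finset.sum_le_sum fun n _ => hC n t ⟨ht.1, ht.2.le.trans hTS⟩

/-- **Step 2 = Thm 3.1 (ii) p.4 HOLDS (`ν > 0`)**: a solution of the class on `[0,T)` whose velocity is
bounded on some `[ε,T) × ℝ³` does not blow up at `T`. Leray's structure theorem
(`finiteEnergy_classical_dichotomy`) from the datum `u 0`: the global branch and a maximal time `T* > T`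
give a finite-energy classical solution on a closed slab `⊇ [0,T]`, hence the `H³` bound
(`not_blowsUpAt_of_finiteEnergy_slab`); `T* < T` is excluded because `u|[0,T*]` is itself a
finite-energy classical continuation; `T* = T` is excluded because the maximal solution equals `u` on
`[0,T)` (uniqueness on each `[0,t]`), which is bounded there — by `M` on `[ε,T)` and by the Sobolev bound
on `[0,ε]` — against the blow-up of `max |u|`. Original source: Leray 1934 §33; Kato 1972 /
Majda–Bertozzi 2002 §3.3 for the class; not the claim. [cite: Iotti2025UniformBound, Thm 3.1 (ii) p.4; p.10 last sentence]
[cite: Leray1934, §33] -/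
theorem step2_holds : Literature.Claims.NS.Iotti2025.Step_2 := by
  intro ν hν T hT v₀ u p hloc hbd
  obtain ⟨ε, hε, M, hM⟩ := hbd
  have hcl : IsClassicalNSSolutionOn (Ico 0 T) ν 0 u p := hloc.isClassical
  obtain ⟨hu₀s, hu₀d, hu₀H⟩ := datum_of_isLocalSolution hT hloc
  rcases finiteEnergy_classical_dichotomy hν hu₀s hu₀d hu₀H with
    hall | ⟨Ts, hTs, U, P, hU, hU0, ⟨A, hA, hAU⟩, hunb, hnone⟩
  · -- every closed slab carries a finite-energy classical solution: take `[0, T]`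
    obtain ⟨w, q, hw, hw0, hEw⟩ := hall T hT
    exact not_blowsUpAt_of_finiteEnergy_slab hν hT hloc le_rfl hw hw0 hEw
  · -- a maximal finite-energy classical solution `U` on `[0, Ts)`
    by_cases hTT : T < Ts
    · -- `Ts > T`: restrict `U` to the closed slab `[0, T]`
      have hw : IsClassicalNSSolutionOn (Icc 0 T) ν 0 U P :=
        hU.mono (Icc_subset_Ico_right hTT) (uniqueDiffOn_Icc hT)
      exact not_blowsUpAt_of_finiteEnergy_slab hν hT hloc le_rfl hw hU0
        ⟨A, hA, fun t ht => hAU t ⟨ht.1, ht.2.trans_lt hTT⟩⟩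
    · intro _hblow
      rcases (not_lt.1 hTT).lt_or_eq with hlt | heq
      · -- `Ts < T`: `u|[0,Ts]` is a finite-energy classical continuation — excluded by maximality
        have huTs : IsClassicalNSSolutionOn (Icc 0 Ts) ν 0 u p :=
          hcl.mono (Icc_subset_Ico_right hlt) (uniqueDiffOn_Icc hTs)
        obtain ⟨C0, hC0⟩ := hloc.sobolev Ts hlt 0
        exact hnone Ts le_rfl u p huTs rfl
          ⟨C0, ENNReal.coe_lt_top, fun t ht => by
            rw [lintegral_enorm_sq_eq_lintegral_iteratedFDeriv_zero]; exact hC0 t ht⟩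
      · -- `Ts = T`: the maximal solution is `u` on `[0,T)`, which is bounded there
        subst heq
        obtain ⟨B, -, hB⟩ := (hloc.sobolev ε hε.2).exists_forall_norm_iteratedFDeriv_le
          (fun t ht => hcl.contDiff_velocity ⟨ht.1, ht.2.trans_lt hε.2⟩) 0
        obtain ⟨t, ht, x, hx⟩ := hunb (max M B)
        have heqt : U t = u t := by
          rcases ht.1.eq_or_lt with h0 | ht0
          · rw [← h0, hU0]
          · have hUt : IsClassicalNSSolutionOn (Icc 0 t) ν 0 U P :=
              hU.mono (Icc_subset_Ico_right ht.2) (uniqueDiffOn_Icc ht0)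
            exact eq_of_finiteEnergy_slab hν hloc ht0 ht.2 hUt hU0
              ⟨A, hA, fun s hs => hAU s ⟨hs.1, hs.2.trans_lt ht.2⟩⟩
        have hbound : ‖u t x‖ ≤ max M B := by
          by_cases htε : t < ε
          · have h1 := hB t ⟨ht.1, htε.le⟩ x
            rw [norm_iteratedFDeriv_zero] at h1
            exact h1.trans (le_max_right _ _)
          · exact (hM t ⟨not_lt.1 htε, ht.2⟩ x).trans (le_max_left _ _)
        rw [heqt] at hx
        exact absurd hx (not_lt.2 hbound)

end Iotti2025

end Summit.NavierStokesRegularity.NavierStokesRegularity.Theorems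

end

-- WHAT THIS IS NOT: not a claim about NS regularity or blow-up; not a claim about any author beyond the
-- typed locator.
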